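import Mathlib
import Summits.CriticalPhenomena.PercolationContinuityZ3.Theorems.PercNearOneGluingNearOneGluingRescueTwo
import Summits.CriticalPhenomena.PercolationContinuityZ3.Theorems.PercNearOneGluingNearOneGluingMaxattTwo
import HarnessLib

/-!
# Crux `PercNearOneGluing.NearOneGluing` (stmt-CriticalPhenomena-4574), line `SketchR2I5` — stub `stub_maxattTwoStrong`

Helper file for the crux (lead prover-line-stmt-CriticalPhenomena-4574-c4): the **strong form of
the two-relay MAXATT inequality** (least-reliable-first gluing inequality, `|A| = 2`, arbitrary
depth), i.e. the landed `stub_maxattTwo` improved by the covariance of the family's attachment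
event with the family's joint survival.  Proves exactly the registered stub signature; lands with
`--supports stmt-CriticalPhenomena-4574`.

## Content

Finite weighted graph on `Fin n`, `μ = prodBernoulli w` on bond configurations
`ω : Set (Sym2 (Fin n))`, target `b`, source `o`, two relays `x, y` with `μ(y ↔ b) ≤ μ(x ↔ b)`
(`y` is the less reliable one).  Attachment events `X = {o ↔ x inside {v | v ≠ b ∧ v ≠ y}}`,
`Y = {o ↔ y inside {v | v ≠ b ∧ v ≠ x}}`, `F = X ∪ Y`, joint survival
`Wal = {x ↔ b} ∪ {y ↔ b}`.  THEOREM (`stub_maxattTwoStrong`):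

`μ(o ↮ b, F) + [μ(F ∩ Wal) − μ(F) μ(Wal)] ≤ μ(y ↮ b) · μ(Y) + μ(x ↮ b) · μ(X ∖ Y)`.

Proof.  On `X`, `o ↔ x`, so `o ↔ b ⟺ x ↔ b`; on `Y`, `o ↔ b ⟺ y ↔ b`.  Hence, with the rescue
events `f₁ = {y ↮ b} ∩ {x ↔ b}` and `f₂ = {x ↮ b} ∩ {y ↔ b}`,
`μ(o ↔ b, F) = μ(y ↔ b, Y) + μ(x ↔ b, X ∖ Y)`,
`μ(y ↔ b, Y) = μ(Wal ∩ Y) − μ(Y ∩ f₁)`, `μ(x ↔ b, X ∖ Y) = μ(Wal ∩ (X ∖ Y)) − μ((X ∖ Y) ∩ f₂)`,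
`μ(Wal) = μ(y ↔ b) + μ(f₁) = μ(x ↔ b) + μ(f₂)`, `μ(F) = μ(Y) + μ(X ∖ Y)`.  Substituting, the claim
is *equivalent* to `μ(Y ∩ f₁) + μ((X ∖ Y) ∩ f₂) ≤ μ(Y) μ(f₁) + μ(X ∖ Y) μ(f₂)`, which is the landed
two-relay rescue inequality `stub_rescueTwo` (van den Berg–Häggström–Kahn 2006 Thm. 1.5 twice plus
Harris) applied with its `(y, z) := (x, y)`, `S := {v | v ≠ b ∧ v ≠ y}`, `S' := {v | v ≠ b ∧ v ≠ x}`.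
-/

namespace Summit.CriticalPhenomena.PercolationContinuityZ3.Theorems

open MeasureTheory Set Literature.Probability.LatticeModels Literature.Probability.Percolation
open scoped Classical BigOperators

/-- **Strong two-relay MAXATT** (least-reliable-first gluing inequality for `|A| = 2`, arbitrary
depth, with the covariance gain): with `X = {o ↔ x inside {v ≠ b, v ≠ y}}`,
`Y = {o ↔ y inside {v ≠ b, v ≠ x}}`, `F = X ∪ Y`, `Wal = {x ↔ b} ∪ {y ↔ b}` and
`μ(y ↔ b) ≤ μ(x ↔ b)`:
`μ(o ↮ b, F) + [μ(F ∩ Wal) − μ(F) μ(Wal)] ≤ μ(y ↮ b)·μ(Y) + μ(x ↮ b)·μ(X ∖ Y)`.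
An exact rewriting of the two-relay rescue inequality `stub_rescueTwo`. -/
theorem stub_maxattTwoStrong :
    ∀ (n : ℕ) (w : Sym2 (Fin n) → unitInterval) (o b x y : Fin n),
      (prodBernoulli w).real (openConn y b) ≤ (prodBernoulli w).real (openConn x b) →
      (prodBernoulli w).real {ω | ω ∉ openConn o b ∧
          (ω ∈ openConnIn {v : Fin n | v ≠ b ∧ v ≠ y} o x ∨ ω ∈ openConnIn {v : Fin n | v ≠ b ∧ v ≠ x} o y)} +
        ((prodBernoulli w).real ((openConnIn {v : Fin n | v ≠ b ∧ v ≠ y} o x ∪ openConnIn {v : Fin n | v ≠ b ∧ v ≠ x} o y) ∩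
              (openConn x b ∪ openConn y b)) -
          (prodBernoulli w).real (openConnIn {v : Fin n | v ≠ b ∧ v ≠ y} o x ∪ openConnIn {v : Fin n | v ≠ b ∧ v ≠ x} o y) *
            (prodBernoulli w).real (openConn x b ∪ openConn y b)) ≤
        (prodBernoulli w).real (openConn y b)ᶜ *
            (prodBernoulli w).real (openConnIn {v : Fin n | v ≠ b ∧ v ≠ x} o y) +
          (prodBernoulli w).real (openConn x b)ᶜ *
            (prodBernoulli w).real
              (openConnIn {v : Fin n | v ≠ b ∧ v ≠ y} o x \ openConnIn {v : Fin n | v ≠ b ∧ v ≠ x} o y) := by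
  intro n w o b x y hle
  -- the two-relay rescue inequality with `(y, z) := (x, y)`
  have hres := stub_rescueTwo n w {v : Fin n | v ≠ b ∧ v ≠ y} {v : Fin n | v ≠ b ∧ v ≠ x} o b x y hle
  -- notation
  set μ := prodBernoulli w with hμ
  set X : Set (BondConfig (Fin n)) := openConnIn {v : Fin n | v ≠ b ∧ v ≠ y} o x with hX
  set Y : Set (BondConfig (Fin n)) := openConnIn {v : Fin n | v ≠ b ∧ v ≠ x} o y with hY
  set Bx : Set (BondConfig (Fin n)) := openConn x b with hBx
  set By : Set (BondConfig (Fin n)) := openConn y b with hBy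
  set Bo : Set (BondConfig (Fin n)) := openConn o b with hBo
  have hm : ∀ s : Set (BondConfig (Fin n)), MeasurableSet s := fun s => MeasurableSet.of_discrete
  -- pointwise facts
  have hXo : ∀ ω ∈ X, (ω ∈ Bo ↔ ω ∈ Bx) := by
    intro ω hω
    have hox : (openGraph ω).Reachable o x := maxattTwo_openConn_of_openConnIn hω
    exact ⟨fun h => hox.symm.trans h, fun h => hox.trans h⟩
  have hYo : ∀ ω ∈ Y, (ω ∈ Bo ↔ ω ∈ By) := by
    intro ω hω
    have hoy : (openGraph ω).Reachable o y := maxattTwo_openConn_of_openConnIn hω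
    exact ⟨fun h => hoy.symm.trans h, fun h => hoy.trans h⟩
  -- measure identities
  have hXY : μ.real (X ∪ Y) = μ.real Y + μ.real (X \ Y) := by
    rw [← measureReal_union (Set.disjoint_sdiff_right) (hm _), Set.union_sdiff_self, Set.union_comm]
  have hbad : μ.real {ω | ω ∉ Bo ∧ (ω ∈ X ∨ ω ∈ Y)} = μ.real (X ∪ Y) - μ.real (Bo ∩ (X ∪ Y)) := by
    have h1 : {ω | ω ∉ Bo ∧ (ω ∈ X ∨ ω ∈ Y)} = (X ∪ Y) \ (Bo ∩ (X ∪ Y)) := by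
      ext ω; simp only [Set.mem_setOf_eq, Set.mem_sdiff, Set.mem_union, Set.mem_inter_iff]; tauto
    rw [h1, measureReal_sdiff (Set.inter_subset_right) (hm _)]
  have hgood : μ.real (Bo ∩ (X ∪ Y)) = μ.real (Bx ∩ (X \ Y)) + μ.real (By ∩ Y) := by
    have h1 : Bo ∩ (X ∪ Y) = (Bx ∩ (X \ Y)) ∪ (By ∩ Y) := by
      ext ω
      simp only [Set.mem_inter_iff, Set.mem_union, Set.mem_sdiff]
      constructor
      · rintro ⟨hb, hx | hy⟩
        · by_cases hy : ω ∈ Y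
          · exact Or.inr ⟨(hYo ω hy).1 hb, hy⟩
          · exact Or.inl ⟨(hXo ω hx).1 hb, hx, hy⟩
        · exact Or.inr ⟨(hYo ω hy).1 hb, hy⟩
      · rintro (⟨hb, hx, -⟩ | ⟨hb, hy⟩)
        · exact ⟨(hXo ω hx).2 hb, Or.inl hx⟩
        · exact ⟨(hYo ω hy).2 hb, Or.inr hy⟩
    rw [h1, measureReal_union _ (hm _)]
    exact Set.disjoint_left.2 fun ω h1 h2 => h1.2.2 h2.2
  -- `Wal ∩ Y = (By ∩ Y) ⊔ (Y ∩ f₁)` and `Wal ∩ (X ∖ Y) = (Bx ∩ (X ∖ Y)) ⊔ ((X ∖ Y) ∩ f₂)`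
  have hWY : μ.real ((Bx ∪ By) ∩ Y) = μ.real (By ∩ Y) + μ.real (Y ∩ (Byᶜ ∩ Bx)) := by
    have h1 : (Bx ∪ By) ∩ Y = (By ∩ Y) ∪ (Y ∩ (Byᶜ ∩ Bx)) := by
      ext ω; simp only [Set.mem_inter_iff, Set.mem_union, Set.mem_compl_iff]; tauto
    rw [h1, measureReal_union _ (hm _)]
    exact Set.disjoint_left.2 fun ω h1 h2 => h2.2.1 h1.1
  have hWX : μ.real ((Bx ∪ By) ∩ (X \ Y)) =
      μ.real (Bx ∩ (X \ Y)) + μ.real ((X \ Y) ∩ (Bxᶜ ∩ By)) := by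
    have h1 : (Bx ∪ By) ∩ (X \ Y) = (Bx ∩ (X \ Y)) ∪ ((X \ Y) ∩ (Bxᶜ ∩ By)) := by
      ext ω; simp only [Set.mem_inter_iff, Set.mem_union, Set.mem_compl_iff, Set.mem_sdiff]; tauto
    rw [h1, measureReal_union _ (hm _)]
    exact Set.disjoint_left.2 fun ω h1 h2 => h2.2.1 h1.1
  -- `F ∩ Wal = (Wal ∩ Y) ⊔ (Wal ∩ (X ∖ Y))`
  have hFW : μ.real ((X ∪ Y) ∩ (Bx ∪ By)) =
      μ.real ((Bx ∪ By) ∩ Y) + μ.real ((Bx ∪ By) ∩ (X \ Y)) := by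
    have h1 : (X ∪ Y) ∩ (Bx ∪ By) = ((Bx ∪ By) ∩ Y) ∪ ((Bx ∪ By) ∩ (X \ Y)) := by
      ext ω; simp only [Set.mem_inter_iff, Set.mem_union, Set.mem_sdiff]; tauto
    rw [h1, measureReal_union _ (hm _)]
    exact Set.disjoint_left.2 fun ω h1 h2 => h2.2.2 h1.2
  -- `Wal = By ⊔ f₁ = Bx ⊔ f₂`
  have hWy : μ.real (Bx ∪ By) = μ.real By + μ.real (Byᶜ ∩ Bx) := by
    have h1 : Bx ∪ By = By ∪ (Byᶜ ∩ Bx) := by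
      ext ω; simp only [Set.mem_inter_iff, Set.mem_union, Set.mem_compl_iff]; tauto
    rw [h1, measureReal_union _ (hm _)]
    exact Set.disjoint_left.2 fun ω h1 h2 => h2.1 h1
  have hWx : μ.real (Bx ∪ By) = μ.real Bx + μ.real (Bxᶜ ∩ By) := by
    have h1 : Bx ∪ By = Bx ∪ (Bxᶜ ∩ By) := by
      ext ω; simp only [Set.mem_inter_iff, Set.mem_union, Set.mem_compl_iff]; tauto
    rw [h1, measureReal_union _ (hm _)]
    exact Set.disjoint_left.2 fun ω h1 h2 => h2.1 h1
  -- complements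
  have hcx : μ.real Bxᶜ = 1 - μ.real Bx := probReal_compl_eq_one_sub (hm _)
  have hcy : μ.real Byᶜ = 1 - μ.real By := probReal_compl_eq_one_sub (hm _)
  -- products
  have p0 : μ.real (X ∪ Y) * μ.real (Bx ∪ By) =
      μ.real Y * μ.real (Bx ∪ By) + μ.real (X \ Y) * μ.real (Bx ∪ By) := by
    rw [hXY]; ring
  have p1 : μ.real Y * μ.real (Bx ∪ By) = μ.real Y * μ.real By + μ.real Y * μ.real (Byᶜ ∩ Bx) := by
    rw [hWy]; ring
  have p2 : μ.real (X \ Y) * μ.real (Bx ∪ By) =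
      μ.real (X \ Y) * μ.real Bx + μ.real (X \ Y) * μ.real (Bxᶜ ∩ By) := by
    rw [hWx]; ring
  have p3 : μ.real Byᶜ * μ.real Y = μ.real Y - μ.real By * μ.real Y := by
    rw [hcy]; ring
  have p4 : μ.real Bxᶜ * μ.real (X \ Y) = μ.real (X \ Y) - μ.real Bx * μ.real (X \ Y) := by
    rw [hcx]; ring
  linarith [hres, hbad, hgood, hWY, hWX, hFW, hXY, p0, p1, p2, p3, p4]

end Summit.CriticalPhenomena.PercolationContinuityZ3.Theorems
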